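import Literature.MathematicalPhysics.StatisticalMechanics.LennardJonesClusters
import HarnessLib

/-!
# Route `BrittleRungDescent`, support item `LadderGroundStates` (stmt-AtomisticToContinuum-10945):
# binding and compactness for a general pair potential

Helper file (part 1 of the existence half of `LadderGroundStates`). The discharge
`LennardJonesGroundStatesExist_holds` of `LennardJonesClusters.lean` proves the existence of
Lennard-Jones ground states by the argument printed in Blanc–Lewin 2015, §1.2 (strict binding (6)
from the minimisers of the smaller problems, then compactness modulo translations). That argument
uses only the following properties of the pair potential `V : ℝ → ℝ`, and this file re-runs its
lemmas in that generality (so that they apply to every rung `miePotential q` of the Mie ladder):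

* `V 0 = 0` (Lean's junk value at coincident points, never met by distinct points; it makes the
  full double sum `∑ᵢ ∑ₖ V(|xᵢ - x_k|)` equal to `2 𝓔_N`);
* `c ≤ V` (stability: `E(N)` is a genuine infimum, `groundStateEnergy_le_of_le`);
* `V < 0` on `(1, ∞)` ("two groups of particles far away always attract each other");
* `-ε ≤ V` on `[t, ∞)` (the attractive tail is small far away);
* `V` continuous on `(0, ∞)`.

Contents: `apply_dist_le_two_mul_interactionEnergy` (a pair term is controlled by the total
energy), `groundStateEnergy_add_lt` (strict binding `E(K+M) < E(K) + E(M)` from minimisers),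
`le_interactionEnergy_of_far` (escaping groups cost binding energy),
`continuousOn_interactionEnergy`, `exists_isGroundState_of_bounds` (compactness modulo
translations). Part 2 (`…LadderGroundStatesExistence.lean`) adds the binding level, the induction
step and the specialisation to `miePotential q`.
-/

noncomputable section

open scoped BigOperators Topology
open Metric Set Filter

namespace Summit.AtomisticToContinuum.Crystallization.Theorems

open Literature.MathematicalPhysics.StatisticalMechanics

namespace LadderGroundStates

variable {V : ℝ → ℝ} {c : ℝ} {d N : ℕ}

/-- **A pair term is controlled by the total energy**: if `c ≤ V` and `V 0 = 0`, then in any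
configuration `V(|xᵢ - x_k|) ≤ 2 𝓔_N(x) + N² |c|` (all the other terms of the full double sum are
`≥ -|c|`). [folklore] -/
theorem apply_dist_le_two_mul_interactionEnergy (h0 : V 0 = 0) (hc : ∀ r, c ≤ V r)
    (x : Fin N → EuclideanSpace ℝ (Fin d)) (i k : Fin N) :
    V (dist (x i) (x k)) ≤ 2 * interactionEnergy V x + (N : ℝ) ^ 2 * |c| := by
  rw [two_mul_interactionEnergy_eq_sum_sum V h0]
  set F : Fin N → Fin N → ℝ := fun i k => V (dist (x i) (x k)) + |c| with hF
  have hF0 : ∀ i k, 0 ≤ F i k := fun i k => by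
    have h1 := hc (dist (x i) (x k))
    have h2 := neg_abs_le c
    simp only [hF]
    linarith
  have h1 : F i k ≤ ∑ k', F i k' :=
    Finset.single_le_sum (f := fun k' => F i k') (fun k' _ => hF0 i k') (Finset.mem_univ k)
  have h2 : ∑ k', F i k' ≤ ∑ i', ∑ k', F i' k' :=
    Finset.single_le_sum (f := fun i' => ∑ k', F i' k') (fun i' _ => Finset.sum_nonneg
      fun k' _ => hF0 i' k') (Finset.mem_univ i)
  have h3 : ∑ i', ∑ k', F i' k' =
      ∑ i', ∑ k', V (dist (x i') (x k')) + (N : ℝ) ^ 2 * |c| := by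
    simp only [hF, Finset.sum_add_distrib, Finset.sum_const, Finset.card_univ, Fintype.card_fin,
      nsmul_eq_mul]
    ring
  have h4 : F i k = V (dist (x i) (x k)) + |c| := rfl
  have h5 := abs_nonneg c
  linarith

/-- **Strict binding inequality** `E(K+M) < E(K) + E(M)` (Blanc–Lewin 2015, (6)) for a potential
with `V 0 = 0`, bounded below and negative on `(1, ∞)`, given minimisers `y`, `z` of the `K`- and
`M`-particle problems (`K, M ≥ 1`, `d ≥ 1`): place `z` translated far away from `y`; all cross
distances exceed `1`, where `V < 0`. [cite: BlancLewin2015, §1.2 (6)] -/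
theorem groundStateEnergy_add_lt (hd : 0 < d) (h0 : V 0 = 0) (hc : ∀ r, c ≤ V r)
    (hneg : ∀ s, 1 < s → V s < 0) {K M : ℕ} (hK : 0 < K) (hM : 0 < M)
    {y : Fin K → EuclideanSpace ℝ (Fin d)} (hy : IsGroundState V y)
    {z : Fin M → EuclideanSpace ℝ (Fin d)} (hz : IsGroundState V z) :
    groundStateEnergy V d (K + M) < groundStateEnergy V d K + groundStateEnergy V d M := by
  set R : ℝ := 2 + ∑ i, ‖y i‖ + ∑ j, ‖z j‖ with hR
  set e : EuclideanSpace ℝ (Fin d) := EuclideanSpace.single (⟨0, hd⟩ : Fin d) R with he_def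
  have hR0 : 0 ≤ R :=
    add_nonneg (add_nonneg zero_le_two (Finset.sum_nonneg fun _ _ => norm_nonneg _))
      (Finset.sum_nonneg fun _ _ => norm_nonneg _)
  have hen : ‖e‖ = R := by simp [he_def, abs_of_nonneg hR0]
  set z' : Fin M → EuclideanSpace ℝ (Fin d) := fun j => z j + e with hz'
  have hfar : ∀ i j, 1 < dist (y i) (z' j) := fun i j => by
    have hyi : ‖y i‖ ≤ ∑ i', ‖y i'‖ :=
      Finset.single_le_sum (f := fun i' => ‖y i'‖) (fun _ _ => norm_nonneg _) (Finset.mem_univ i)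
    have hzj : ‖z j‖ ≤ ∑ j', ‖z j'‖ :=
      Finset.single_le_sum (f := fun j' => ‖z j'‖) (fun _ _ => norm_nonneg _) (Finset.mem_univ j)
    have h1 : ‖e‖ - ‖y i - z j‖ ≤ dist (y i) (z' j) := by
      rw [dist_comm, dist_eq_norm]
      have e1 : e - (z' j - y i) = y i - z j := by simp only [hz']; abel
      have := norm_sub_norm_le e (z' j - y i)
      rw [e1] at this
      linarith
    have h2 : ‖y i - z j‖ ≤ ‖y i‖ + ‖z j‖ := norm_sub_le _ _
    linarith
  have hne : ∀ i j, y i ≠ z' j := fun i j h => by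
    have := hfar i j
    rw [h, dist_self] at this
    norm_num at this
  have hz'inj : Function.Injective z' := fun a b hab => hz.1 (add_right_cancel hab)
  set w : Fin (K + M) → EuclideanSpace ℝ (Fin d) := Fin.append y z' with hw
  have hinj : Function.Injective w := by
    intro a b hab
    induction a using Fin.addCases with
    | left a =>
      induction b using Fin.addCases with
      | left b =>
        simp only [hw, Fin.append_left] at hab
        rw [hy.1 hab]
      | right b =>
        simp only [hw, Fin.append_left, Fin.append_right] at hab
        exact absurd hab (hne a b)
    | right a =>
      induction b using Fin.addCases with
      | left b =>
        simp only [hw, Fin.append_left, Fin.append_right] at hab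
        exact absurd hab.symm (hne b a)
      | right b =>
        simp only [hw, Fin.append_right] at hab
        rw [hz'inj hab]
  have hle : groundStateEnergy V d (K + M) ≤ interactionEnergy V w :=
    groundStateEnergy_le_of_le V hc hinj
  have hdec := interactionEnergy_append V h0 y z'
  have hz'E : interactionEnergy V z' = interactionEnergy V z := interactionEnergy_add_const V z e
  have hnegsum : ∑ i, ∑ j, V (dist (y i) (z' j)) < 0 := by
    have hKne : (Finset.univ : Finset (Fin K)).Nonempty := ⟨⟨0, hK⟩, Finset.mem_univ _⟩
    have hMne : (Finset.univ : Finset (Fin M)).Nonempty := ⟨⟨0, hM⟩, Finset.mem_univ _⟩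
    exact Finset.sum_neg (fun i _ => Finset.sum_neg (fun j _ => hneg _ (hfar i j)) hMne) hKne
  rw [hw] at hle
  rw [hdec, hz'E, hy.2, hz.2] at hle
  linarith

/-- **Escaping groups cost binding energy.** If the indices split into `S` and `Sᶜ` with all
cross distances `≥ t`, and `-ε ≤ V` on `[t, ∞)`, then
`𝓔_N(x) ≥ E(#S) + E(#Sᶜ) - #S · #Sᶜ · ε` (for `V 0 = 0`, `V` bounded below, `x` injective).
[cite: BlancLewin2015, §1.2] -/
theorem le_interactionEnergy_of_far (h0 : V 0 = 0) (hc : ∀ r, c ≤ V r)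
    {x : Fin N → EuclideanSpace ℝ (Fin d)} (hx : Function.Injective x) (S : Finset (Fin N))
    {t ε : ℝ} (hε : ∀ s, t ≤ s → -ε ≤ V s)
    (hfar : ∀ i ∈ S, ∀ k ∈ Sᶜ, t ≤ dist (x i) (x k)) :
    groundStateEnergy V d S.card + groundStateEnergy V d Sᶜ.card -
        (S.card : ℝ) * (Sᶜ.card : ℝ) * ε ≤ interactionEnergy V x := by
  have h2 := two_mul_interactionEnergy_eq_sum_sum V h0 x
  rw [sum_sum_eq_add_compl _ S] at h2
  have hS := two_mul_groundStateEnergy_card_le V h0 hc hx S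
  have hSc := two_mul_groundStateEnergy_card_le V h0 hc hx Sᶜ
  have hc1 : ∑ i ∈ S, ∑ k ∈ Sᶜ, -ε ≤ ∑ i ∈ S, ∑ k ∈ Sᶜ, V (dist (x i) (x k)) :=
    Finset.sum_le_sum fun i hi => Finset.sum_le_sum fun k hk => hε _ (hfar i hi k hk)
  have hc2 : ∑ i ∈ Sᶜ, ∑ k ∈ S, -ε ≤ ∑ i ∈ Sᶜ, ∑ k ∈ S, V (dist (x i) (x k)) :=
    Finset.sum_le_sum fun i hi => Finset.sum_le_sum fun k hk =>
      hε _ (by rw [dist_comm]; exact hfar k hk i hi)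
  simp only [Finset.sum_const, nsmul_eq_mul] at hc1 hc2
  linarith

/-- The interaction energy is continuous on the set of `δ`-separated configurations (`δ > 0`),
for a potential continuous on `(0, ∞)`. [folklore] -/
theorem continuousOn_interactionEnergy (hcont : ContinuousOn V (Set.Ioi 0)) {δ : ℝ}
    (hδ : 0 < δ) :
    ContinuousOn (fun x : Fin N → EuclideanSpace ℝ (Fin d) => interactionEnergy V x)
      {x | ∀ i k, i ≠ k → δ ≤ dist (x i) (x k)} := by
  have h : ∀ i k : Fin N, i ≠ k → ContinuousOn
      (fun x : Fin N → EuclideanSpace ℝ (Fin d) => V (dist (x i) (x k)))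
      {x | ∀ i k, i ≠ k → δ ≤ dist (x i) (x k)} := by
    intro i k hik
    have hf : Continuous fun x : Fin N → EuclideanSpace ℝ (Fin d) => dist (x i) (x k) :=
      (continuous_apply i).dist (continuous_apply k)
    refine hcont.comp hf.continuousOn ?_
    intro x hx
    exact hδ.trans_le (hx i k hik)
  unfold interactionEnergy
  exact continuousOn_finsetSum _ fun i _ => continuousOn_finsetSum _ fun k hk =>
    h i k (Finset.mem_Ioi.1 hk).ne

/-- **Compactness modulo translations** (Blanc–Lewin 2015, §1.2, footnote to (6)). If every
configuration of `N` distinct points with energy below a level `B' > E(N)` has diameter `≤ R` and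
mutual distances `≥ δ > 0`, then `E(N)` has a minimiser (for `V` bounded below and continuous on
`(0, ∞)`): after translating particle `i₀` to the origin such configurations lie in a compact set
on which the energy is continuous, and a minimiser of the energy on that set is a ground state.
[cite: BlancLewin2015, §1.2 (6)] -/
theorem exists_isGroundState_of_bounds (hc : ∀ r, c ≤ V r) (hcont : ContinuousOn V (Set.Ioi 0))
    (i₀ : Fin N) {B' R δ : ℝ}
    (hne : Nonempty {x : Fin N → EuclideanSpace ℝ (Fin d) // Function.Injective x})
    (hB' : groundStateEnergy V d N < B') (hδ : 0 < δ)
    (hR : ∀ x : Fin N → EuclideanSpace ℝ (Fin d), Function.Injective x →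
      interactionEnergy V x < B' → ∀ i k, dist (x i) (x k) ≤ R)
    (hsep : ∀ x : Fin N → EuclideanSpace ℝ (Fin d), Function.Injective x →
      interactionEnergy V x < B' → ∀ i k, i ≠ k → δ ≤ dist (x i) (x k)) :
    ∃ x : Fin N → EuclideanSpace ℝ (Fin d), IsGroundState V x := by
  -- a near-minimiser `x₁`
  have hB'' := hB'
  unfold groundStateEnergy at hB''
  obtain ⟨⟨x₁, hx₁⟩, hx₁E⟩ := exists_lt_of_ciInf_lt hB''
  simp only at hx₁E
  have hR0 : 0 ≤ R := by
    have := hR x₁ hx₁ hx₁E i₀ i₀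
    rwa [dist_self] at this
  -- the compact set of normalised configurations
  set C : Set (Fin N → EuclideanSpace ℝ (Fin d)) :=
    {x | x i₀ = 0} ∩ {x | ∀ i, ‖x i‖ ≤ R} ∩ {x | ∀ i k, i ≠ k → δ ≤ dist (x i) (x k)} with hC
  have hCcpt : IsCompact C := isCompact_setOf_normalised i₀ hR0 δ
  have hcontE : ContinuousOn
      (fun x : Fin N → EuclideanSpace ℝ (Fin d) => interactionEnergy V x) C :=
    (continuousOn_interactionEnergy hcont hδ).mono Set.inter_subset_right
  -- normalisation: translate `x i₀` to the origin
  have hnorm : ∀ x : Fin N → EuclideanSpace ℝ (Fin d), Function.Injective x →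
      interactionEnergy V x < B' → (fun i => x i - x i₀) ∈ C := by
    intro x hx hxE
    refine ⟨⟨?_, fun i => ?_⟩, fun i k hik => ?_⟩
    · show x i₀ - x i₀ = 0
      exact sub_self _
    · rw [← dist_eq_norm]
      exact hR x hx hxE i i₀
    · rw [dist_sub_right]
      exact hsep x hx hxE i k hik
  have hx₀C : (fun i => x₁ i - x₁ i₀) ∈ C := hnorm x₁ hx₁ hx₁E
  have hx₀E : interactionEnergy V (fun i => x₁ i - x₁ i₀) < B' := by
    rw [interactionEnergy_sub_const]
    exact hx₁E
  -- minimise the (continuous) energy over the compact set `C`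
  obtain ⟨xm, hxmC, hmin⟩ := hCcpt.exists_isMinOn ⟨_, hx₀C⟩ hcontE
  rw [isMinOn_iff] at hmin
  have hxm_inj : Function.Injective xm := by
    intro i k h
    by_contra hik
    have := hxmC.2 i k hik
    rw [h, dist_self] at this
    exact absurd this (not_le.2 hδ)
  have hxmE : interactionEnergy V xm < B' := (hmin _ hx₀C).trans_lt hx₀E
  refine ⟨xm, hxm_inj, le_antisymm ?_ (groundStateEnergy_le_of_le V hc hxm_inj)⟩
  unfold groundStateEnergy
  refine le_ciInf fun y => ?_
  by_cases hyE : interactionEnergy V y.1 < B'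
  · have h := hmin _ (hnorm y.1 y.2 hyE)
    rwa [interactionEnergy_sub_const] at h
  · exact hxmE.le.trans (not_lt.1 hyE)

end LadderGroundStates

end Summit.AtomisticToContinuum.Crystallization.Theorems

end
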